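import Summits.QuantumFields.YangMills.Theorems.BalabanUVNodesN07KLHOfThm312
import HarnessLib

/-!
# BalabanUVNodes ∕ N07 — THE (KL-N) ONE-BLOCK LETTER OF `Δπ∘H₁(U₀)` (PT-B G1's five binders `hk′ ∕ hNk ∕ Θ′ ∕ N₁`) REDUCED BY NAME TO ONE DISPLAYED
# (130)∕(3.132)-SHAPE BLOCK-ENTRY DECAY ROW FOR THE RECORD's `DeltaPiCurOfRecord … Gp Q′♭ ∘ H1OfRecordAtBgFlat`, NODE-00 REGIME

Track A of `YM-PLAN.md` (cell `pub-ymgap`, HUMAN RULING D-0062), DAG node **N07** = [Balaban1985Variational] («[B11]», CMP **102** (1985) 277–309); [B9] =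
[Balaban1985BackgroundPropagators] (CMP **99** (1985) 389–434); [4] = [Balaban1984PropagatorsII].  Seat `pub-ymgap-dag-n07-e` (g39): ★★★ director-ym №588 row (b) ∕ dag-lead TABLE
v148 «(KL-N) OPEN -b slot on N07, first INTENT by basename takes it» (WORDS 809 (3) START HERE) — INTENT-4.  `--supports stmt-QuantumFields-27238 --as helper`; count-neutral.
Sequel of ✓`…N07Prop4LetterHOfThm312` (MODULE 145: `singleBIdx`, `blkOfBond`, `rowSum_PBond_le`, `tdist_comm_rec`) and of dag-n06-l's ✓`…N07KLHOfThm312` (the (KL-H) twin: `card_fiber_blkOfBond_le`,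
`sum_over_blocks_le`, `levWeight_bondLevLit_eq_one_pow` — consumed BY NAME, not retyped).

THE PRINT.  [B11] p. 291: *«⟨A′, Δ_π HD(A′)⟩ = ⟨A′, (Δ_U + DRD\*)HD(A′)⟩ (87) … Applying the inequalities (3.132) from [5], (55), (73), and remembering that the symbol a above represents the
operator of multiplication by (Lʲη)⁻² … we can estimate this functional derivative by O(1)ε₁(Lʲη)⁻³ on Ω_j»* (88); [B11] (130) p. 298 (the Laplacian entry of an H-kernel): *«|(Δ_{U₀}H_{0,μν})(x, y′)| ≦
B₀(L^jη)^{−3}(L^{j′}η)^{−d}e^{−δ₀d(y,y′)}, x ∈ Δ(y), y ∈ Λ_j, y′ ∈ Λ_{j′}»*; [B9] (3.132) p. 422 (`|(QGQ*)⁻¹(y, y′)| ≤ …e^{−δ₁d(y,y′)}`); [4] Lemma 2.1 (2.61) p. 234 (row sum).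

THE LETTER (PT-B G1 ✓`Prop4UniformAtRecord.prop4LetterColumnsAtRecord_of_kernelLetters`, binders (KL-N); consumer G4 ✓`prop4UniformAtRecord_node00_of_h1EntryBounds_coneLetter`):
`hk′ : Bond → PBond k → ℝ≥0` with `hNk : ‖(Δπ(H₁(U₀)(δ_y Z)))(b′)‖ ≤ hk′(b′, y)·‖Z‖` (`Δπ := DeltaPiCurOfRecord F N K k Ω U₀ Gp (QflatOfRecord F N k)`, def-Y's W₇ letter of (80)∕(87)–(89),
`H₁(U₀) := H1OfRecordAtBgFlat …`), the (3)∕(1)-weighted fine-column sums `Σ_{b′} w₃(bb)∕w₁(b′)·hk′(b′, y) ≤ Θ′` and the weighted row sums `Σ_y w₃(b′)∕w_B(y)·hk′(b′, y) ≤ N₁`.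

WHAT THIS FILE DOES (the (KL-N) analogue of n06-l's (KL-H) reduction; nothing of either sibling restated):
* §1 `nCol0 … Gp y b′ : M_N(ℂ) →L[ℂ] M_N(ℂ)` = `X ↦ (Δπ(H₁(U₀)(δ_y X)))(b′)` — the fine column of `Δπ∘H₁(U₀)` (`NegSup.evalCLM ∘ Δπ ∘ H₁ ∘ singleBIdx`); `nCol0_apply`; ★ `norm_deltaPiH1_single_le` —
  G1's `hNk` VERBATIM at `hk′(b′, y) := ‖nCol0 y b′‖_op` (`le_opNorm`).
* §2 `nEntry0 … Gp y″ y := sup⁺_{b′ ∈ Δ(y″)} ‖nCol0 y b′‖` — the block-sup entry «sup_{x∈Δ(y″)}|(Δ_πH₁)_{μν}(x, y)|» ((130)'s reading for `Δπ∘H₁`; lit `fsup`); `opNorm_nCol0_le_nEntry0`;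
  `sum_opNorm_nCol0_le` (fine-column sum ≤ `(L^d)^k` × the block-entry sum, n06-l's `sum_over_blocks_le`).
* §3 ★★★ `klN_of_nEntryBounds`: in the node-00 regime (`∀ x, x ∈ Ω k`, standing range `k ≤ m + K`), the DISPLAYED decay row `nEntry0 y″ y ≤ B₀·e^{−ρ·d(y″,y)}` (`d` = `tdist` of the
  sources) ⟹ G1's FIVE (KL-N) binders with `Θ′ := (L^d)^k · B₀ · d(2(1+1∕ρ))^d` (block count × the (2.61) row sum over the observation index — NOT k-free, exactly like n06-l's `Θ_H`;
  G1 multiplies it by (KL-C)'s coarse-column constant `G ~ η^d`) and `N₁ := B₀ · d(2(1+1∕ρ))^d` (the (2.61) row sum over the B-index — k-free given k-free `B₀, ρ`); all (115) and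
  B-size weights are `1` at the top level.

HONEST FRAMING.  BY-NAME REDUCTION + bookkeeping; the antecedent `h0` is a DISPLAYED (130)∕(3.132)-SHAPE block-entry decay for the record's `Δπ∘H₁(U₀)`, stated INLINE (no `def : Prop`),
NOT a clause of any `B9.*Printed` schema — its print route is (87)–(88): the identity `⟨A′, Δ_πHD A′⟩ = ⟨A′, (Δ_U + DRD*)HD A′⟩` plus (3.132) for `(QG₁Q*)⁻¹`, whose by-name discharge
at def-Y's letters (the record identity `Δπ∘H₁ = Q*∘(…)` + `B9.Stmt3132Printed` at a record instance) is NOT typed here; nothing of [B9]∕[B11] proved; (KL-C), the (ℓd) assembly and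
Prop. 4 stay PT-B's; K0ᴬ ⟨27238⟩ NOT closed; COUNT 8∕28 · K 1∕4 UNMOVED; one finite 𝕋⁴ programme at fixed ε — NOT continuum ∕ OS ∕ Clay; **the Yang–Mills mass gap is NOT
proved by any of this.**  No `sorry`, no `instance`, no `notation`; standard axioms.
-/

noncomputable section
open scoped Matrix Matrix.Norms.L2Operator InnerProductSpace ComplexConjugate BigOperators
namespace Summit.QuantumFields.YangMills.BalabanUVNodes.N07KLNOfEntryBounds

open Literature.MathematicalPhysics.QuantumFieldTheory.Balaban1983to89
open Literature.MathematicalPhysics.QuantumFieldTheory.Balaban1983to89.Node00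
open T4Continuum (T4Family)
open B9SectCLatticeCarrier (Bond)
open B11Eq103H1Complex (SiteL2K)
open B11Eq115Space (NegSup NegSize Space115 JetSup levWeight levWeight_apply)
open B11Eq111FrakG (nabla115)
open B11KernelDictionary (fsup le_fsup fsup_nonneg)
open Summit.QuantumFields.YangMills.BalabanUVNodes.N07Prop4LetterHOfThm312 (singleBIdx singleBIdx_apply blkOfBond rowSum_PBond_le tdist_comm_rec)
open Summit.QuantumFields.YangMills.BalabanUVNodes.N07KLHOfThm312 (sum_over_blocks_le levWeight_bondLevLit_eq_one_pow)

section Member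

variable (F : T4Family) (N : ℕ) (K k : ℕ) (Ω : ℕ → Set (Site (F.P K) 0)) (U₀ : GaugeField (F.P K) 0 (SU N)) (levB : PBond (F.P K) k → ℕ)
variable [Fact (0 < (F.L : ℝ))] [Fact (0 < (F.P K).eta k)] [Fact (0 < c0Rec F K k)] [Fact (∀ c, 0 < wBRec F K k c)] (a : ℝ)
  (hpos : ∀ x, x ≠ 0 → 0 < RCLike.re ⟪x, laplaceAOfRecord F N k U₀ (QOfRecord F N k U₀) (QflatOfRecord F N k) a x⟫_ℂ)
  (hQ : Function.Surjective (QOfRecord F N k U₀))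
  (Gp : SiteL2K ℂ (F.P K).d (fun _ => (F.P K).sitesPerDir 0) (c0Rec F K k) (WRec N) →ₗ[ℂ]
    SiteL2K ℂ (F.P K).d (fun _ => (F.P K).sitesPerDir 0) (c0Rec F K k) (WRec N))

/-! ## §1 The fine column of `Δπ∘H₁(U₀)` and G1's one-block bound `hNk` -/

omit [Fact (0 < (F.L : ℝ))] [Fact (0 < (F.P K).eta k)] [Fact (0 < c0Rec F K k)] [Fact (∀ c, 0 < wBRec F K k c)] in
/-- `δ_y Z` spelled as PT-B writes it: `singleBIdx y Z = (NegSup.equiv …).symm (Pi.single y Z)` (`rfl`). [cite: Balaban1985Variational, (45) p.285 (bookkeeping)] -/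
theorem singleBIdx_eq_symm_single (y : PBond (F.P K) k) (Z : Matrix (Fin N) (Fin N) ℂ) :
    singleBIdx F N K k levB y Z = (NegSup.equiv (levWeight (F.L : ℝ) ((F.P K).eta k) levB 0) (Matrix (Fin N) (Fin N) ℂ)).symm (Pi.single y Z) := rfl

/-- **THE FINE COLUMN OF `Δπ∘H₁(U₀)`** at the B-index `y` and the fine bond `b′`: `X ↦ (Δπ(H₁(U₀)(δ_y X)))(b′) : M_N(ℂ) →L[ℂ] M_N(ℂ)` as the composition
`eval_{b′} ∘ Δπ ∘ H₁(U₀) ∘ δ_y` of def-Y's CLMs (`Δπ := DeltaPiCurOfRecord … Gp Q′♭`, the W₇ letter, a `|·|₍₋₃₎`-current-valued CLM on (115); `H₁(U₀) := H1OfRecordAtBgFlat …`) —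
print's kernel entry `(Δ_πH₁)_{μν}(b′, y)` as a colour operator (top-level pairing volume `1`).  The two halves carry their types EXPLICITLY (so that no elaboration ever evaluates the
operators: the composite is never unfolded against its pointwise value by `rfl`, only REWRITTEN through `coe_comp`). [cite: Balaban1985Variational, (80) p.290, (87)–(88) p.291, (130) p.298] -/
noncomputable def nCol0 (y : PBond (F.P K) k) (b' : Bond (F.P K).d (fun _ => (F.P K).sitesPerDir 0)) : Matrix (Fin N) (Fin N) ℂ →L[ℂ] Matrix (Fin N) (Fin N) ℂ :=
  (((NegSup.evalCLM ℂ (levWeight (F.L : ℝ) ((F.P K).eta k) (bondLevLit F Ω k) 3) b').comp (DeltaPiCurOfRecord F N K k Ω U₀ Gp (QflatOfRecord F N k)) :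
      Space115Lit F N K k Ω U₀ →L[ℂ] Matrix (Fin N) (Fin N) ℂ)).comp
    (((H1OfRecordAtBgFlat F N K k Ω U₀ levB a hpos hQ).comp (LinearMap.toContinuousLinearMap (singleBIdx F N K k levB y)) :
      Matrix (Fin N) (Fin N) ℂ →L[ℂ] Space115Lit F N K k Ω U₀))

/-- ★ **G1's ONE-BLOCK BOUND `hNk` WITH `hk′(b′, y) := ‖nCol0 y b′‖_op`**: `‖(Δπ(H₁(U₀)(δ_y Z)))(b′)‖ ≤ ‖nCol0 y b′‖·‖Z‖` — PT-B's binder shape verbatim (the operator norm of the composite,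
read pointwise through `coe_comp` ∕ `evalCLM_apply` ∕ `coe_toContinuousLinearMap'` ∕ `singleBIdx_eq_symm_single`). [cite: Balaban1985Variational, (87)–(88) p.291] -/
theorem norm_deltaPiH1_single_le (y : PBond (F.P K) k) (Z : Matrix (Fin N) (Fin N) ℂ) (b' : Bond (F.P K).d (fun _ => (F.P K).sitesPerDir 0)) :
    ‖NegSup.equiv (levWeight (F.L : ℝ) ((F.P K).eta k) (bondLevLit F Ω k) 3) (Matrix (Fin N) (Fin N) ℂ)
        (DeltaPiCurOfRecord F N K k Ω U₀ Gp (QflatOfRecord F N k) (H1OfRecordAtBgFlat F N K k Ω U₀ levB a hpos hQ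
          ((NegSup.equiv (levWeight (F.L : ℝ) ((F.P K).eta k) levB 0) (Matrix (Fin N) (Fin N) ℂ)).symm (Pi.single y Z)))) b'‖ ≤
      ‖nCol0 F N K k Ω U₀ levB a hpos hQ Gp y b'‖ * ‖Z‖ := by
  have h := ContinuousLinearMap.le_opNorm
    ((((NegSup.evalCLM ℂ (levWeight (F.L : ℝ) ((F.P K).eta k) (bondLevLit F Ω k) 3) b').comp (DeltaPiCurOfRecord F N K k Ω U₀ Gp (QflatOfRecord F N k)) :
      Space115Lit F N K k Ω U₀ →L[ℂ] Matrix (Fin N) (Fin N) ℂ)).comp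
    (((H1OfRecordAtBgFlat F N K k Ω U₀ levB a hpos hQ).comp (LinearMap.toContinuousLinearMap (singleBIdx F N K k levB y)) :
      Matrix (Fin N) (Fin N) ℂ →L[ℂ] Space115Lit F N K k Ω U₀))) Z
  simp only [ContinuousLinearMap.coe_comp, Function.comp_apply, NegSup.evalCLM_apply, LinearMap.coe_toContinuousLinearMap',
    singleBIdx_eq_symm_single] at h
  exact h

/-! ## §2 The (130)-shape block-sup entry of `Δπ∘H₁(U₀)` and the fine-column sum through it -/

open Classical in
/-- **`sup_{x∈Δ(y″)}|(Δ_πH₁)_{μν}(x, y)|` OF RECORD** — the block sup (lit's `fsup`, floor `0`) over the fine bonds `b′` of the observation block `y″` of the column operator norms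
`‖nCol0 y b′‖` ((130)'s reading for the operator `Δπ∘H₁(U₀)`). [cite: Balaban1985Variational, (130) p.298, (88) p.291] -/
noncomputable def nEntry0 (y'' y : PBond (F.P K) k) : ℝ :=
  fsup fun b' : Bond (F.P K).d (fun _ => (F.P K).sitesPerDir 0) => if blkOfBond F K k b' = y'' then ‖nCol0 F N K k Ω U₀ levB a hpos hQ Gp y b'‖ else 0

/-- Each fine column is dominated by the entry of its observation block: `‖nCol0 y b′‖ ≤ nEntry0 Δ⁻¹(b′) y`. [cite: Balaban1985Variational, (130) p.298 (bookkeeping)] -/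
theorem opNorm_nCol0_le_nEntry0 (y : PBond (F.P K) k) (b' : Bond (F.P K).d (fun _ => (F.P K).sitesPerDir 0)) :
    ‖nCol0 F N K k Ω U₀ levB a hpos hQ Gp y b'‖ ≤ nEntry0 F N K k Ω U₀ levB a hpos hQ Gp (blkOfBond F K k b') y := by
  classical
  unfold nEntry0
  refine le_trans (le_of_eq ?_) (le_fsup _ b')
  rw [if_pos rfl]

/-- **THE FINE-COLUMN SUM THROUGH THE BLOCK ENTRIES**: `Σ_{b′} ‖nCol0 y b′‖ ≤ (L^d)^k · Σ_{y″} nEntry0 y″ y` (at most `(L^d)^k` fine bonds per observation block, n06-l's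
✓`sum_over_blocks_le`; standing range `k ≤ m + K`). [cite: Balaban1984PropagatorsII, (2.52) p.232; Balaban1985Variational, (130) p.298] -/
theorem sum_opNorm_nCol0_le (hk : k ≤ (F.P K).m + (F.P K).K) (y : PBond (F.P K) k) :
    ∑ b' : Bond (F.P K).d (fun _ => (F.P K).sitesPerDir 0), ‖nCol0 F N K k Ω U₀ levB a hpos hQ Gp y b'‖ ≤
      (((F.P K).L ^ (F.P K).d) ^ k : ℕ) * ∑ y'' : PBond (F.P K) k, nEntry0 F N K k Ω U₀ levB a hpos hQ Gp y'' y := by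
  refine le_trans (Finset.sum_le_sum fun b' _ => opNorm_nCol0_le_nEntry0 F N K k Ω U₀ levB a hpos hQ Gp y b') ?_
  exact sum_over_blocks_le F K k hk (fun y'' => nEntry0 F N K k Ω U₀ levB a hpos hQ Gp y'' y) (fun _ => fsup_nonneg _)

/-! ## §3 One member: G1's five (KL-N) binders from the displayed block-entry decay row, node-00 regime -/

/-- ★★★ **(KL-N) AT ONE MEMBER FROM A (130)∕(3.132)-SHAPE BLOCK-ENTRY DECAY ROW, NODE-00 REGIME.**  If every site lies in `Ω_k`, `k ≤ m + K`, and the block-sup entries of the record's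
`Δπ∘H₁(U₀)` obey `nEntry0 y″ y ≤ B₀·e^{−ρ·d(y″,y)}` (`d` = `tdist` of the sources — DISPLAYED; print's (87)–(88) via (3.132)), then PT-B G1's FIVE (KL-N) binders hold with
`hk′(b′, y) := ‖nCol0 y b′‖_op`: non-negativity; the one-block bound `hNk`; the (3)∕(1)-weighted fine-column sums `≤ Θ′ := (L^d)^k · B₀ · d(2(1+1∕ρ))^d` (block count × the (2.61) row sum
over the observation index; NOT k-free — G1 pairs it with (KL-C)'s `G ~ η^d`); the weighted row sums over the B-index `≤ N₁ := B₀ · d(2(1+1∕ρ))^d` (k-free); node-00: every (115) weight and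
the B-size weight `(L^{j}η)^0` is `1`. [cite: Balaban1985Variational, (87)–(88) p.291, (130) p.298, (115) p.294; Balaban1985BackgroundPropagators, (3.132) p.422; Balaban1984PropagatorsII, Lemma 2.1 (2.61) p.234] -/
theorem klN_of_nEntryBounds (hΩ : ∀ x, x ∈ Ω k) (hk : k ≤ (F.P K).m + (F.P K).K) {B₀ ρ : ℝ} (hB₀ : 0 ≤ B₀) (hρ : 0 < ρ)
    (h0 : ∀ y'' y : PBond (F.P K) k, nEntry0 F N K k Ω U₀ levB a hpos hQ Gp y'' y ≤ B₀ * Real.exp (-(ρ * (Site.tdist y''.src y.src : ℝ)))) :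
    (∀ (b' : Bond (F.P K).d (fun _ => (F.P K).sitesPerDir 0)) (y : PBond (F.P K) k), 0 ≤ ‖nCol0 F N K k Ω U₀ levB a hpos hQ Gp y b'‖) ∧
    (∀ (y : PBond (F.P K) k) (Z : Matrix (Fin N) (Fin N) ℂ) (b' : Bond (F.P K).d (fun _ => (F.P K).sitesPerDir 0)),
      ‖NegSup.equiv (levWeight (F.L : ℝ) ((F.P K).eta k) (bondLevLit F Ω k) 3) (Matrix (Fin N) (Fin N) ℂ)
          (DeltaPiCurOfRecord F N K k Ω U₀ Gp (QflatOfRecord F N k) (H1OfRecordAtBgFlat F N K k Ω U₀ levB a hpos hQ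
            ((NegSup.equiv (levWeight (F.L : ℝ) ((F.P K).eta k) levB 0) (Matrix (Fin N) (Fin N) ℂ)).symm (Pi.single y Z)))) b'‖ ≤
        ‖nCol0 F N K k Ω U₀ levB a hpos hQ Gp y b'‖ * ‖Z‖) ∧
    (0 ≤ ((((F.P K).L ^ (F.P K).d) ^ k : ℕ) : ℝ) * (B₀ * ((F.P K).d * (2 * (1 + 1 / ρ)) ^ (F.P K).d))) ∧
    (∀ (bb : Bond (F.P K).d (fun _ => (F.P K).sitesPerDir 0)) (y : PBond (F.P K) k),
      ∑ b' : Bond (F.P K).d (fun _ => (F.P K).sitesPerDir 0),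
        levWeight (F.L : ℝ) ((F.P K).eta k) (bondLevLit F Ω k) 3 bb / levWeight (F.L : ℝ) ((F.P K).eta k) (bondLevLit F Ω k) 1 b' *
          ‖nCol0 F N K k Ω U₀ levB a hpos hQ Gp y b'‖ ≤
      ((((F.P K).L ^ (F.P K).d) ^ k : ℕ) : ℝ) * (B₀ * ((F.P K).d * (2 * (1 + 1 / ρ)) ^ (F.P K).d))) ∧
    (0 ≤ B₀ * ((F.P K).d * (2 * (1 + 1 / ρ)) ^ (F.P K).d)) ∧
    (∀ b' : Bond (F.P K).d (fun _ => (F.P K).sitesPerDir 0),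
      ∑ y : PBond (F.P K) k, levWeight (F.L : ℝ) ((F.P K).eta k) (bondLevLit F Ω k) 3 b' / levWeight (F.L : ℝ) ((F.P K).eta k) levB 0 y *
          ‖nCol0 F N K k Ω U₀ levB a hpos hQ Gp y b'‖ ≤
      B₀ * ((F.P K).d * (2 * (1 + 1 / ρ)) ^ (F.P K).d)) := by
  have hC0 : (0 : ℝ) ≤ (F.P K).d * (2 * (1 + 1 / ρ)) ^ (F.P K).d := by positivity
  -- the (2.61) row sum over the OBSERVATION index (column sums): `Σ_{y″} nEntry0 y″ y ≤ B₀·c`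
  have hcol : ∀ y : PBond (F.P K) k,
      ∑ y'' : PBond (F.P K) k, nEntry0 F N K k Ω U₀ levB a hpos hQ Gp y'' y ≤ B₀ * ((F.P K).d * (2 * (1 + 1 / ρ)) ^ (F.P K).d) := by
    intro y
    calc ∑ y'' : PBond (F.P K) k, nEntry0 F N K k Ω U₀ levB a hpos hQ Gp y'' y
        ≤ ∑ y'' : PBond (F.P K) k, B₀ * Real.exp (-(ρ * (Site.tdist y.src y''.src : ℝ))) :=
          Finset.sum_le_sum fun y'' _ => by rw [tdist_comm_rec F K]; exact h0 y'' y
      _ = B₀ * ∑ y'' : PBond (F.P K) k, Real.exp (-(ρ * (Site.tdist y.src y''.src : ℝ))) := by rw [Finset.mul_sum]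
      _ ≤ B₀ * ((F.P K).d * (2 * (1 + 1 / ρ)) ^ (F.P K).d) := mul_le_mul_of_nonneg_left (rowSum_PBond_le F K k y hρ) hB₀
  -- the fine-column sums
  have hsum : ∀ y : PBond (F.P K) k, ∑ b' : Bond (F.P K).d (fun _ => (F.P K).sitesPerDir 0), ‖nCol0 F N K k Ω U₀ levB a hpos hQ Gp y b'‖ ≤
      ((((F.P K).L ^ (F.P K).d) ^ k : ℕ) : ℝ) * (B₀ * ((F.P K).d * (2 * (1 + 1 / ρ)) ^ (F.P K).d)) := fun y =>
    (sum_opNorm_nCol0_le F N K k Ω U₀ levB a hpos hQ Gp hk y).trans (mul_le_mul_of_nonneg_left (hcol y) (Nat.cast_nonneg _))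
  -- the (2.61) row sum over the B-INDEX (row sums): `Σ_y ‖nCol0 y b′‖ ≤ Σ_y nEntry0 Δ⁻¹(b′) y ≤ B₀·c`
  have hrow : ∀ b' : Bond (F.P K).d (fun _ => (F.P K).sitesPerDir 0),
      ∑ y : PBond (F.P K) k, ‖nCol0 F N K k Ω U₀ levB a hpos hQ Gp y b'‖ ≤ B₀ * ((F.P K).d * (2 * (1 + 1 / ρ)) ^ (F.P K).d) := by
    intro b'
    calc ∑ y : PBond (F.P K) k, ‖nCol0 F N K k Ω U₀ levB a hpos hQ Gp y b'‖
        ≤ ∑ y : PBond (F.P K) k, B₀ * Real.exp (-(ρ * (Site.tdist (blkOfBond F K k b').src y.src : ℝ))) :=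
          Finset.sum_le_sum fun y _ => (opNorm_nCol0_le_nEntry0 F N K k Ω U₀ levB a hpos hQ Gp y b').trans (h0 _ y)
      _ = B₀ * ∑ y : PBond (F.P K) k, Real.exp (-(ρ * (Site.tdist (blkOfBond F K k b').src y.src : ℝ))) := by rw [Finset.mul_sum]
      _ ≤ B₀ * ((F.P K).d * (2 * (1 + 1 / ρ)) ^ (F.P K).d) := mul_le_mul_of_nonneg_left (rowSum_PBond_le F K k _ hρ) hB₀
  refine ⟨fun b' y => ContinuousLinearMap.opNorm_nonneg _, fun y Z b' => norm_deltaPiH1_single_le F N K k Ω U₀ levB a hpos hQ Gp y Z b',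
    mul_nonneg (Nat.cast_nonneg _) (mul_nonneg hB₀ hC0), fun bb y => ?_, mul_nonneg hB₀ hC0, fun b' => ?_⟩
  · calc ∑ b' : Bond (F.P K).d (fun _ => (F.P K).sitesPerDir 0),
          levWeight (F.L : ℝ) ((F.P K).eta k) (bondLevLit F Ω k) 3 bb / levWeight (F.L : ℝ) ((F.P K).eta k) (bondLevLit F Ω k) 1 b' *
            ‖nCol0 F N K k Ω U₀ levB a hpos hQ Gp y b'‖
        = ∑ b' : Bond (F.P K).d (fun _ => (F.P K).sitesPerDir 0), ‖nCol0 F N K k Ω U₀ levB a hpos hQ Gp y b'‖ :=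
          Finset.sum_congr rfl fun b' _ => by
            rw [levWeight_bondLevLit_eq_one_pow F K k Ω hΩ 3 bb, levWeight_bondLevLit_eq_one_pow F K k Ω hΩ 1 b', div_one, one_mul]
      _ ≤ _ := hsum y
  · calc ∑ y : PBond (F.P K) k, levWeight (F.L : ℝ) ((F.P K).eta k) (bondLevLit F Ω k) 3 b' / levWeight (F.L : ℝ) ((F.P K).eta k) levB 0 y *
            ‖nCol0 F N K k Ω U₀ levB a hpos hQ Gp y b'‖
        = ∑ y : PBond (F.P K) k, ‖nCol0 F N K k Ω U₀ levB a hpos hQ Gp y b'‖ :=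
          Finset.sum_congr rfl fun y _ => by
            rw [levWeight_bondLevLit_eq_one_pow F K k Ω hΩ 3 b', levWeight_apply, pow_zero, div_one, one_mul]
      _ ≤ _ := hrow b'

end Member

end Summit.QuantumFields.YangMills.BalabanUVNodes.N07KLNOfEntryBounds
end
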